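import Summits.QuantumAdvantage.QuantumAdvantage.Theorems.ArithStatLadderIqThreeNotPPolyStubShiftPairsCount

/-!
# Crux `ArithStatLadder.IqThreeNotPPoly` (stmt-QuantumAdvantage-2422)

Stub `stub_shiftPairsCountFive` of the line `Sketch` (rung R5): COUNTING SHIFTED SQUAREFREE PAIRS
WITH A PLANTED FACTOR `5`.

For `n ≥ 48` and every bit position `j` with `n + 24 ≤ 2j` and `j + 2 ≤ n`, at least `2ⁿ / 16384`
numerals `N ∈ [2^{n-1}, 2ⁿ)` satisfy: `N ≡ 3 (mod 4)`, bit `j` of `N` is `0`, `N` is squarefree,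
`5 ∣ N` (so `N` is composite), and `9 ∣ N + 2ʲ` (so the bit-`j` flip `N + 2ʲ` is not squarefree).

Proof (elementary, explicit constants; the landed sieve `stub_apSieve` and the block geometry of
rung R3). We count numerals `N = 5N'`. Pick `a < 180`, coprime to `180`, with `a ≡ 3 (mod 4)`,
`a ≡ 1 (mod 5)` and `5a ≡ -2ʲ (mod 9)` (from R3's residue `a₀ (mod 36)`: `a ≡ 29 a₀ (mod 36)`,
`29 = 5⁻¹ (mod 36)`, lifted to the class `≡ 1 (mod 5)`). If `N' ≡ a (mod 180)` then `N = 5N'` has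
`N ≡ 3 (mod 4)`, `9 ∣ N + 2ʲ`, `5 ∣ N`, and `N` is squarefree iff `N'` is (`gcd(5, N') = 1`).
The numerals in `[2^{n-1}, 2ⁿ)` whose bit `j` is zero form `M = 2^{n-2-j}` dyadic blocks
`[b_m, b_m + 2ʲ)`, `b_m = 2^{n-1} + m·2^{j+1}`. In block `m` consider `N = 5(x_m + 180k)`, `k < K`,
`K = ⌊2ʲ/900⌋ - 2`, where `x_m ∈ [b_m/5 + 1, b_m/5 + 181)` is `≡ a (mod 180)`: these `N` lie in
`(b_m, b_m + 2ʲ)`, so they satisfy the bit and size conditions, and by `stub_apSieve` (modulus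
`180`; every prime not dividing `180` is `≥ 7`) at most `K/6 + √(2ⁿ)` of the `x_m + 180k` are not
squarefree. As `2048·√(2ⁿ) ≤ 2ʲ` (this is where `j ≥ n/2 + 12` enters), every block contributes
`≥ (5K - 6√(2ⁿ))/6 ≥ 2ʲ/4096` good numerals, and `(m, k) ↦ 5(x_m + 180k)` is injective (the block
index is read off from `N / 2^{j+1} = M + m`), whence `#good ≥ M·2ʲ/4096 = 2ⁿ/16384`.
-/

set_option linter.dupNamespace false -- D-0017: single-problem summit ⇒ `QuantumAdvantage.QuantumAdvantage` by design

namespace Summit.QuantumAdvantage.QuantumAdvantage.Theorems.IqThreeNotPPoly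

open scoped Classical
open Finset

/-- A prime not dividing `180` is at least `7` (the primes below `7` are `2`, `3`, `5`). -/
theorem shiftFive_prime_ge_seven : ∀ p : ℕ, p.Prime → ¬ p ∣ 180 → 7 ≤ p := by
  intro p hp hdvd
  by_contra h
  have h2 := hp.two_le
  interval_cases p
  · exact hdvd (by norm_num)
  · exact hdvd (by norm_num)
  · exact absurd hp (by norm_num)
  · exact hdvd (by norm_num)
  · exact absurd hp (by norm_num)

/-- The residue class of `N' = N / 5`: for every `j` there is `a < 180`, coprime to `180`, with
`a ≡ 3 (mod 4)`, `a ≡ 1 (mod 5)` and `9 ∣ 5a + 2ʲ` (take R3's `a₀ (mod 36)`, multiply by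
`29 = 5⁻¹ (mod 36)`, and lift to the class `≡ 1 (mod 5)` modulo `180`). -/
theorem shiftFive_residue (j : ℕ) :
    ∃ a : ℕ, a < 180 ∧ a % 4 = 3 ∧ a % 5 = 1 ∧ (5 * a + 2 ^ j) % 9 = 0 ∧ Nat.Coprime a 180 := by
  obtain ⟨a₀, -, ha4, ha9, -⟩ := shiftPairs_residue j
  have h3 : ¬ 3 ∣ 2 ^ j := by
    intro h
    have := Nat.Prime.dvd_of_dvd_pow Nat.prime_three h
    omega
  obtain ⟨P, hP⟩ : ∃ P : ℕ, P = 2 ^ j := ⟨_, rfl⟩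
  rw [← hP] at h3 ha9 ⊢
  obtain ⟨a, ha⟩ : ∃ a : ℕ, a = 29 * a₀ % 36 + 36 * ((6 - 29 * a₀ % 36 % 5) % 5) := ⟨_, rfl⟩
  have hn2 : ¬ 2 ∣ a := by omega
  have hn3 : ¬ 3 ∣ a := by omega
  have hn5 : ¬ 5 ∣ a := by omega
  refine ⟨a, by omega, by omega, by omega, by omega, ?_⟩
  have hc2 : Nat.Coprime a 2 := ((Nat.Prime.coprime_iff_not_dvd Nat.prime_two).2 hn2).symm
  have hc3 : Nat.Coprime a 3 := ((Nat.Prime.coprime_iff_not_dvd Nat.prime_three).2 hn3).symm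
  have hc5 : Nat.Coprime a 5 := ((Nat.Prime.coprime_iff_not_dvd Nat.prime_five).2 hn5).symm
  have h180 : (180 : ℕ) = 2 ^ 2 * 3 ^ 2 * 5 := by norm_num
  rw [h180]
  exact Nat.Coprime.mul_right (Nat.Coprime.mul_right (hc2.pow_right 2) (hc3.pow_right 2)) hc5

/-- The start of the progression: the least `x ≥ c` with `x ≡ a (mod 180)` lies in `[c, c + 180)`
and is coprime to `180` when `a` is. -/
theorem shiftFive_ap_start (a c : ℕ) (ha : a < 180) (hcop : Nat.Coprime a 180) :
    ∃ x : ℕ, c ≤ x ∧ x < c + 180 ∧ x % 180 = a ∧ Nat.Coprime x 180 := by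
  refine ⟨c + (a + 180 - c % 180) % 180, by omega, by omega, by omega, ?_⟩
  have e : c + (a + 180 - c % 180) % 180 =
      a + 180 * ((c + (a + 180 - c % 180) % 180) / 180) := by
    omega
  rw [e, Nat.coprime_add_mul_left_left]
  exact hcop

/-- The block index of a numeral `N ∈ [b_m, b_m + 2ʲ)`, `b_m = 2^{n-1} + m·2^{j+1}`:
`N / 2^{j+1} = 2^{n-2-j} + m` (R3's block geometry). -/
theorem shiftFive_ap_div (n j m N : ℕ) (hjn : j + 2 ≤ n) (hm : m < 2 ^ (n - 2 - j))
    (h1 : 2 ^ (n - 1) + m * 2 ^ (j + 1) ≤ N) (h2 : N < 2 ^ (n - 1) + m * 2 ^ (j + 1) + 2 ^ j) :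
    N / 2 ^ (j + 1) = 2 ^ (n - 2 - j) + m := by
  obtain ⟨t, ht⟩ : ∃ t, N = 2 ^ (n - 1) + m * 2 ^ (j + 1) + t :=
    ⟨N - (2 ^ (n - 1) + m * 2 ^ (j + 1)), by omega⟩
  have htA : t < 2 ^ (j + 1) := by rw [pow_succ]; omega
  rw [ht]
  exact (shiftPairs_block n j m t hjn hm htA).2

/-- Each numeral `N = 5(x + 180k)` with `x ≡ a (mod 180)`, `N ∈ [b_m, b_m + 2ʲ)` and `x + 180k`
squarefree is one of the numerals counted by the stub: `N ≡ 15 ≡ 3 (mod 4)`, bit `j` of `N` is `0`,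
`N` is squarefree (`gcd(5, x + 180k) = 1` as `x + 180k ≡ 1 (mod 5)`), `5 ∣ N`, and
`N + 2ʲ ≡ 5a + 2ʲ ≡ 0 (mod 9)`. -/
theorem shiftFive_ap_mem (n j a m x k : ℕ) (hjn : j + 2 ≤ n) (hm : m < 2 ^ (n - 2 - j))
    (ha4 : a % 4 = 3) (ha5 : a % 5 = 1) (ha9 : (5 * a + 2 ^ j) % 9 = 0) (hx : x % 180 = a)
    (h1 : 2 ^ (n - 1) + m * 2 ^ (j + 1) ≤ 5 * (x + 180 * k))
    (h2 : 5 * (x + 180 * k) < 2 ^ (n - 1) + m * 2 ^ (j + 1) + 2 ^ j)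
    (hsq : Squarefree (x + 180 * k)) :
    5 * (x + 180 * k) ∈ (Finset.range (2 ^ n)).filter (fun N : ℕ =>
      2 ^ (n - 1) ≤ N ∧ N % 4 = 3 ∧ N.testBit j = false ∧ Squarefree N ∧ 5 ∣ N ∧
        9 ∣ N + 2 ^ j) := by
  obtain ⟨t, ht⟩ : ∃ t, 5 * (x + 180 * k) = 2 ^ (n - 1) + m * 2 ^ (j + 1) + t :=
    ⟨5 * (x + 180 * k) - (2 ^ (n - 1) + m * 2 ^ (j + 1)), by omega⟩
  have htj : t < 2 ^ j := by omega
  have htA : t < 2 ^ (j + 1) := by rw [pow_succ]; omega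
  have hlt : 5 * (x + 180 * k) < 2 ^ n := by
    rw [ht]; exact (shiftPairs_block n j m t hjn hm htA).1
  have hbit : (5 * (x + 180 * k)).testBit j = false := by
    rw [ht]; exact shiftPairs_testBit n j m t hjn htj
  have hcop : Nat.Coprime 5 (x + 180 * k) := by
    rw [Nat.Prime.coprime_iff_not_dvd Nat.prime_five]; omega
  have hsq5 : Squarefree (5 * (x + 180 * k)) :=
    (Nat.squarefree_mul hcop).2 ⟨Nat.prime_five.prime.squarefree, hsq⟩
  rw [Finset.mem_filter, Finset.mem_range]
  exact ⟨hlt, by omega, by omega, hbit, hsq5, Dvd.intro _ rfl, by omega⟩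

/-- The sieve in one block: a progression `x + 180k`, `k < K`, with `gcd(x, 180) = 1` and
`x + 180K ≤ B` has at least `(5K - 6√B)/6` squarefree members (`stub_apSieve` with `p₀ = 7`). -/
theorem shiftFive_block_count (x K B : ℕ) (hcop : Nat.Coprime x 180) (hB : x + 180 * K ≤ B) :
    5 * K ≤ 6 * ((Finset.range K).filter (fun k => Squarefree (x + 180 * k))).card +
      6 * Nat.sqrt B := by
  have hs := stub_apSieve x 180 K 7 (by norm_num) hcop (by norm_num) shiftFive_prime_ge_seven
  have hsq := Nat.sqrt_le_sqrt hB
  have hsum := Finset.card_filter_add_card_filter_not (s := Finset.range K)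
    (fun k => Squarefree (x + 180 * k))
  rw [Finset.card_range] at hsum
  omega

/-- **STUB R5 · `stub_shiftPairsCountFive`**: for `n ≥ 48` and every position `j` with
`n + 24 ≤ 2j`, `j + 2 ≤ n`, at least `2ⁿ/16384` numerals `N ∈ [2^{n-1}, 2ⁿ)` have `N ≡ 3 (mod 4)`,
bit `j` zero, `N` squarefree, `5 ∣ N` and `9 ∣ N + 2ʲ`. -/
theorem stub_shiftPairsCountFive :
    ∃ n₀ : ℕ, ∀ n : ℕ, n₀ ≤ n → ∀ j : ℕ, n + 24 ≤ 2 * j → j + 2 ≤ n →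
      2 ^ n ≤ 16384 * ((Finset.range (2 ^ n)).filter (fun N : ℕ =>
        2 ^ (n - 1) ≤ N ∧ N % 4 = 3 ∧ N.testBit j = false ∧ Squarefree N ∧ 5 ∣ N ∧
          9 ∣ N + 2 ^ j)).card := by
  refine ⟨48, ?_⟩
  intro n hn j hj1 hj2
  obtain ⟨a, ha180, ha4, ha5, ha9, hcop⟩ := shiftFive_residue j
  -- the atoms `M = 2^{n-2-j}` (number of blocks), `K = ⌊2ʲ/900⌋ - 2` (progression length),
  -- `S = √(2ⁿ)` (sieve error) and the linear facts relating them to `2ʲ`, `2ⁿ`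
  obtain ⟨M, hM⟩ : ∃ M : ℕ, M = 2 ^ (n - 2 - j) := ⟨_, rfl⟩
  obtain ⟨K, hK⟩ : ∃ K : ℕ, K = 2 ^ j / 900 - 2 := ⟨_, rfl⟩
  obtain ⟨S, hS⟩ : ∃ S : ℕ, S = Nat.sqrt (2 ^ n) := ⟨_, rfl⟩
  have hP : 16384 ≤ 2 ^ j :=
    calc (16384 : ℕ) = 2 ^ 14 := by norm_num
      _ ≤ 2 ^ j := Nat.pow_le_pow_right (by norm_num) (by omega)
  have hA : (2 : ℕ) ^ (j + 1) = 2 ^ j * 2 := pow_succ 2 j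
  have hK1 : 900 * (K + 2) ≤ 2 ^ j := by omega
  have hK2 : 2 ^ j < 900 * (K + 3) := by omega
  have h2048 : 2048 * S ≤ 2 ^ j := by
    have h1 : S < 2 ^ (n / 2 + 1) := by
      rw [hS, Nat.sqrt_lt', ← pow_mul]
      exact Nat.pow_lt_pow_right (by norm_num) (by omega)
    have h2 : 2048 * 2 ^ (n / 2 + 1) ≤ 2 ^ j := by
      rw [show (2048 : ℕ) = 2 ^ 11 by norm_num, ← pow_add]
      exact Nat.pow_le_pow_right (by norm_num) (by omega)
    omega
  have hlin : 3 * 2 ^ j + 12288 * S ≤ 10240 * K := by omega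
  have h2n : 2 ^ n = 4 * (M * 2 ^ j) := by
    have e : n - 2 - j + j + 2 = n := by omega
    rw [hM]
    calc (2 : ℕ) ^ n = 2 ^ (n - 2 - j + j + 2) := by rw [e]
      _ = 4 * (2 ^ (n - 2 - j) * 2 ^ j) := by rw [pow_add, pow_add]; ring
  -- the progressions `N' = x m + 180 k`: `x m ≡ a (mod 180)` in `[b_m/5 + 1, b_m/5 + 181)`,
  -- `b_m = 2^{n-1} + m·2^{j+1}`, so that `N = 5 N' ∈ (b_m, b_m + 2ʲ)` for `k < K`
  have hex : ∀ m : ℕ, ∃ x : ℕ, (2 ^ (n - 1) + m * 2 ^ (j + 1)) / 5 + 1 ≤ x ∧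
      x < (2 ^ (n - 1) + m * 2 ^ (j + 1)) / 5 + 1 + 180 ∧ x % 180 = a ∧ Nat.Coprime x 180 :=
    fun m => shiftFive_ap_start a _ ha180 hcop
  choose x hx using hex
  -- per-block count
  have hblock : ∀ m ∈ Finset.range M,
      5 * K ≤ 6 * ((Finset.range K).filter (fun k => Squarefree (x m + 180 * k))).card +
        6 * S := by
    intro m hm
    rw [Finset.mem_range] at hm
    obtain ⟨hx1, hx2, -, hx4⟩ := hx m
    rw [hS]
    refine shiftFive_block_count (x m) K (2 ^ n) hx4 ?_
    obtain ⟨t, ht⟩ : ∃ t, 5 * (x m + 180 * K) = 2 ^ (n - 1) + m * 2 ^ (j + 1) + t :=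
      ⟨5 * (x m + 180 * K) - (2 ^ (n - 1) + m * 2 ^ (j + 1)), by omega⟩
    have htA : t < 2 ^ (j + 1) := by omega
    have := (shiftPairs_block n j m t hj2 (by omega) htA).1
    omega
  -- injection `(m, k) ↦ 5 (x m + 180 k)` of the good pairs into the target set
  refine le_trans ?_ (Nat.mul_le_mul_left 16384 (Finset.card_le_card_of_injOn
    (s := (Finset.range M).sigma
      (fun m => (Finset.range K).filter (fun k => Squarefree (x m + 180 * k))))
    (fun mk => 5 * (x mk.1 + 180 * mk.2)) ?maps ?inj))
  case maps =>
    rintro ⟨m, k⟩ hmk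
    simp only [Finset.coe_sigma, Set.mem_sigma_iff, Finset.mem_coe, Finset.mem_range,
      Finset.mem_filter] at hmk
    obtain ⟨hm, hk, hsq⟩ := hmk
    obtain ⟨hx1, hx2, hx3, -⟩ := hx m
    exact Finset.mem_coe.2 (shiftFive_ap_mem n j a m (x m) k hj2 (by omega) ha4 ha5 ha9 hx3
      (by omega) (by omega) hsq)
  case inj =>
    rintro ⟨m₁, k₁⟩ h₁ ⟨m₂, k₂⟩ h₂ heq
    simp only [Finset.coe_sigma, Set.mem_sigma_iff, Finset.mem_coe, Finset.mem_range,
      Finset.mem_filter] at h₁ h₂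
    have heq' : 5 * (x m₁ + 180 * k₁) = 5 * (x m₂ + 180 * k₂) := heq
    obtain ⟨hx1, hx2, -, -⟩ := hx m₁
    obtain ⟨hy1, hy2, -, -⟩ := hx m₂
    have e₁ := shiftFive_ap_div n j m₁ (5 * (x m₁ + 180 * k₁)) hj2 (by omega) (by omega)
      (by omega)
    have e₂ := shiftFive_ap_div n j m₂ (5 * (x m₂ + 180 * k₂)) hj2 (by omega) (by omega)
      (by omega)
    rw [heq'] at e₁
    have hm : m₁ = m₂ := by omega
    subst hm
    have hk : k₁ = k₂ := by omega
    subst hk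
    rfl
  -- summation over the blocks and the final arithmetic
  rw [Finset.card_sigma]
  have hsum := Finset.card_nsmul_le_sum (Finset.range M)
    (fun m => 6 * ((Finset.range K).filter (fun k => Squarefree (x m + 180 * k))).card + 6 * S)
    (5 * K) hblock
  rw [Finset.card_range, smul_eq_mul, Finset.sum_add_distrib, ← Finset.mul_sum, Finset.sum_const,
    Finset.card_range, smul_eq_mul] at hsum
  have h6 := Nat.mul_le_mul_left M hlin
  linarith

end Summit.QuantumAdvantage.QuantumAdvantage.Theorems.IqThreeNotPPoly
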